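import Summits.QuantumFields.YangMills.Theorems.FluctuationComparisonRegPrIntLHistoryPartition
import HarnessLib

/-!
# LFG^{can}∘ ENGINE SUPPLIER (R2 at the finest level, every depth): THE LEVEL-`0` HOLES OF A HISTORY COST `|Q₀|·θ_K²/4` OF WILSON ACTION, so the Boltzmann factor of run `K` on the
# history event `E_Q` splits as `e^{−β_K A} ≤ (Π_{level-0 holes} e^{−(t/4)·p(g_K)²}) · e^{−(1−t)β_K A}` for every `t ≥ 0` (use `t ∈ (0, 1)`) — the «one small factor per hole, the rest of the
# action kept for the expansion» step of [Balaban1985UV3] (67)–(71), at depth one (`K = J + 1`) ALL deep holes are level `0`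

Cell `ym3-torus` (HUMAN RULING D-0037: rung R3 = continuum `SU(2)` Yang–Mills on `T³` — NOT `d = 4`, NOT infinite volume, NOT a mass gap, NOT the Clay problem); width seat
`ym3-torus-px10` (gen 17), FILE 11 of the px10 LFG lineage; helper of the crux `stmt-QuantumFields-20520` `UnitScaleTilt.FluctuationComparisonRegPrIntL` (`--supports … --as
helper`, NOT a proof of it); a supplier for the ENERGY row `hζ` of the engine package (FILE 10) at its first bite `K = J + 1` (`LOCATE-R1-DEPTH1-r3p1g0.md` §2 (3): «each hole
plaquette is LARGE … carries `e^{−¼β_Kθ_K²}`-type smallness … against the fibre's Gaussian normalisation»).  THEOREMS ONLY: 0 `def`, 0 `instance`, 0 `notation`, 0 `sorry`.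

WHAT.  ✓`…HistoryPartition.card_mul_sq_le_wilsonAction4_of_mem_histEvent` is the CUT-OFF case `K = n` (every label at level `0`).  Here, for ANY comparison height `J ≤ K` and any
discrete history `Q ⊆ LFLabel F K J`, the labels of `Q` AT THE FINEST LEVEL `j = 0` (plaquettes of the run-`K` field itself, large at threshold `θ_K`) cost action:
* §1 `isLarge_level_zero_iff` (a level-`0` label is large iff `θ K ≤ ‖V(∂p) − 1‖`), ★`card_level0_mul_sq_le_wilsonAction4` (`|Q₀|·θ_K²/4 ≤ A(V)` on `E_Q`, by (11) `1 − Re tr ≥ ¼‖· − 1‖²`);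
* §2 ★★`boltzmann_le_prod_smallFactor_mul` — for `0 < γ ≤ 1`, `0 ≤ b₀`, `t ≥ 0` and `V ∈ E_Q`: `boltzmann_K(V) ≤ (Π_{e ∈ Q, j_e = 0} smallFactor L γ b₀ p₀ (t/4) K) · e^{−(1−t)·β_K·A(V)}`
  (`β_K θ_K² = p(g_K)²`, ✓`β_mul_θBal_sq`); `boltzmann_le_prod_smallFactor_mul_depthOne` — at `K = J + 1` with `Q` deep (all labels at level `0`) the product runs over ALL of `Q`:
  exactly the `Π_{l ∈ Q′} sf l` of the engine package's energy row with `a := t/4`, times the kept Gaussian weight `e^{−(1−t)β_K A}`.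

HONEST (CREDITS NOTHING OF THE EXPANSION): an elementary action split; the cluster expansion with holes that turns the kept weight into V-local activities with tree decay (the engine) is
untouched; LFG^{can}∘ ∕ `stub_largeFieldFourPtIntCan` ∕ S2β ∕ the crux 20520 NOT proved; `YM3TorusSU2` NOT proved; the Yang–Mills mass gap (Clay) NOT proved; rung R3 = YM₃ on `T³` —
NOT `d = 4`, NOT infinite volume, NOT a mass gap.
References: [Balaban1985UV3] T. Bałaban, CMP 102 (1985): (7) p.257, (11) p.258, (67)–(71) pp.273–274; [Balaban1989LargeFieldII] CMP 122 (1989): (1.97) p.389.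
-/

set_option autoImplicit false

noncomputable section

open Finset MeasureTheory
open scoped BigOperators
open Literature.MathematicalPhysics.QuantumFieldTheory.Balaban1983to89
open Literature.MathematicalPhysics.QuantumFieldTheory.Balaban1983to89.T3ContinuumYM3Torus
open Literature.MathematicalPhysics.QuantumFieldTheory.Balaban1983to89.T3UnitScaleTilt
open Literature.MathematicalPhysics.QuantumFieldTheory.Balaban1983to89.T3UnitLawDensityEML
open Literature.MathematicalPhysics.QuantumFieldTheory.Balaban1983to89.T3NestedUnitLaws
open Literature.MathematicalPhysics.QuantumFieldTheory.Balaban1983to89.T3TiltDescent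
open Literature.MathematicalPhysics.QuantumFieldTheory.Balaban1983to89.Missing
open Summit.QuantumFields.YangMills.Theorems.FluctuationComparisonRegPrIntLHistoryPartition

namespace Summit.QuantumFields.YangMills.Theorems.FluctuationComparisonRegPrIntLLargeFieldGasHoleEnergy

variable {F : T3Family}

/-! ## §1 The level-`0` holes cost action -/

/-- A label at the finest level `j = 0` is large for `V` iff its plaquette variable of `V` itself is `θ_K`-far from `1` (no averaging at level `0`). [cite: Balaban1985UV3, (7) p.257] -/
theorem isLarge_level_zero_iff (θ : ℕ → ℝ) {J K : ℕ} (h0 : 0 < K - J + 1) (p : Plaq (F.P K) 0)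
    (V : GaugeField (F.P K) 0 (Matrix.specialUnitaryGroup (Fin 2) ℂ)) :
    IsLarge F θ K J V ⟨⟨0, h0⟩, p⟩ ↔ θ K ≤ GaugeGroup.dist1 (GaugeField.plaqHol V p) := by
  simp [IsLarge, Averaging.iter]

open Classical in
/-- ★ **THE LEVEL-`0` HOLES OF A HISTORY COST `|Q₀|·θ_K²/4` OF WILSON ACTION**: for `V ∈ E_Q` (threshold `θ_K ≥ 0`), each label `(0, p) ∈ Q` has `‖V(∂p) − 1‖ ≥ θ_K`, hence
`1 − Re tr V(∂p) ≥ ¼θ_K²` by (11), and these plaquette costs are distinct terms of `A(V)`. [cite: Balaban1985UV3, (11) p.258 and (7) p.257] -/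
theorem card_level0_mul_sq_le_wilsonAction4 {θ : ℕ → ℝ} {J K : ℕ} (hθ : 0 ≤ θ K) {Q : Finset (LFLabel F K J)}
    {V : GaugeField (F.P K) 0 (Matrix.specialUnitaryGroup (Fin 2) ℂ)} (hV : V ∈ histEvent F θ K J Q) :
    ((Q.filter fun e => e.1.val = 0).card : ℝ) * (θ K ^ 2 / 4) ≤ wilsonAction4 V := by
  have h0 : 0 < K - J + 1 := Nat.succ_pos _
  -- the finest-level plaquettes whose label is in `Q`
  set T : Finset (Plaq (F.P K) 0) := Finset.univ.filter (fun p => (⟨⟨0, h0⟩, p⟩ : LFLabel F K J) ∈ Q) with hT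
  have hQT : (Q.filter fun e => e.1.val = 0) = T.image (fun p => (⟨⟨0, h0⟩, p⟩ : LFLabel F K J)) := by
    ext e
    simp only [hT, Finset.mem_image, Finset.mem_filter, Finset.mem_univ, true_and]
    constructor
    · rintro ⟨he, he0⟩
      obtain ⟨⟨j, hj⟩, p⟩ := e
      simp only at he0
      subst he0
      exact ⟨p, he, rfl⟩
    · rintro ⟨p, hp, rfl⟩
      exact ⟨hp, rfl⟩
  have hinj : Function.Injective (fun p : Plaq (F.P K) 0 => (⟨⟨0, h0⟩, p⟩ : LFLabel F K J)) := by
    intro p q h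
    simp only [Sigma.mk.injEq, heq_eq_eq, true_and] at h
    exact h
  have hcard : (Q.filter fun e => e.1.val = 0).card = T.card := by
    rw [hQT, Finset.card_image_of_injective _ hinj]
  -- each plaquette of `T` costs at least `θ_K²/4`
  have hterm : ∀ p ∈ T, θ K ^ 2 / 4 ≤ 1 - GaugeGroup.reTr (GaugeField.plaqHol V p) := by
    intro p hp
    have hpQ : (⟨⟨0, h0⟩, p⟩ : LFLabel F K J) ∈ Q := (Finset.mem_filter.mp hp).2
    have hl : IsLarge F θ K J V ⟨⟨0, h0⟩, p⟩ := (hV ⟨⟨0, h0⟩, p⟩).mp hpQ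
    have hl' : θ K ≤ GaugeGroup.dist1 (GaugeField.plaqHol V p) := (isLarge_level_zero_iff θ h0 p V).mp hl
    have h11 := B10Eq71TorusLocal.dist1_sq_le_specialUnitaryGroup (GaugeField.plaqHol V p)
    have hsq : θ K ^ 2 ≤ GaugeGroup.dist1 (GaugeField.plaqHol V p) ^ 2 := pow_le_pow_left₀ hθ hl' 2
    push_cast at h11
    linarith
  have hsum : (T.card : ℝ) * (θ K ^ 2 / 4) ≤ ∑ p ∈ T, (1 - GaugeGroup.reTr (GaugeField.plaqHol V p)) := by
    have := Finset.card_nsmul_le_sum T (fun p => 1 - GaugeGroup.reTr (GaugeField.plaqHol V p)) (θ K ^ 2 / 4) hterm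
    simpa [nsmul_eq_mul] using this
  have hsub : ∑ p ∈ T, (1 - GaugeGroup.reTr (GaugeField.plaqHol V p)) ≤ wilsonAction4 V := by
    have hle : ∑ p ∈ T, (1 - GaugeGroup.reTr (GaugeField.plaqHol V p)) ≤
        ∑ p, (1 - GaugeGroup.reTr (GaugeField.plaqHol V p)) :=
      Finset.sum_le_univ_sum_of_nonneg fun p => sub_nonneg.mpr (GaugeGroup.reTr_le_one _)
    simpa [wilsonAction4, wilsonAction, one_mul] using hle
  rw [hcard]
  exact hsum.trans hsub

/-! ## §2 The Boltzmann factor on a history event: one small factor per finest hole, the rest of the action kept -/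

open Classical in
/-- ★★ **THE ACTION SPLIT ON `E_Q`**: for `0 < γ ≤ 1`, `0 ≤ b₀`, `t ≥ 0` and `V ∈ E_Q` (thresholds `θBal`),
`e^{−β_K A(V)} ≤ (Π_{e ∈ Q, j_e = 0} e^{−(t/4)·p(g_K)²}) · e^{−(1−t)·β_K·A(V)}` — `t·β_K·A ≥ t·β_K·|Q₀|θ_K²/4 = |Q₀|·(t/4)·p(g_K)²` (✓`β_mul_θBal_sq`).
[cite: Balaban1985UV3, (67)-(71) pp.273-274 and (11) p.258] -/
theorem boltzmann_le_prod_smallFactor_mul {γ b₀ : ℝ} (p₀ : ℝ) (hγ : 0 < γ) (hγ1 : γ ≤ 1) (hb : 0 ≤ b₀) {t : ℝ} (ht0 : 0 ≤ t)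
    {J K : ℕ} (Q : Finset (LFLabel F K J)) {V : GaugeField (F.P K) 0 (Matrix.specialUnitaryGroup (Fin 2) ℂ)}
    (hV : V ∈ histEvent F (θBal F.L γ b₀ p₀) K J Q) :
    boltzmann (F.P K) ((F.scheme ℰp γ).β K) V ≤
      (∏ _e ∈ Q.filter (fun e => e.1.val = 0), smallFactor F.L γ b₀ p₀ (t / 4) K) *
        Real.exp (-((1 - t) * ((F.scheme ℰp γ).β K * wilsonAction4 V))) := by
  have hβ0 : 0 ≤ (F.scheme ℰp γ).β K := F.scheme_β_nonneg ℰp hγ.le K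
  have hA := card_level0_mul_sq_le_wilsonAction4 (F := F) (θ := θBal F.L γ b₀ p₀) (θBal_nonneg F hγ hγ1 hb p₀ K) hV
  have hkey := β_mul_θBal_sq F hγ b₀ p₀ K
  rw [Finset.prod_const, boltzmann, smallFactor, ← Real.exp_nat_mul, ← Real.exp_add]
  apply Real.exp_le_exp.mpr
  -- `t·β·|Q₀|θ²/4 ≤ t·β·A`
  have h1 : t * ((F.scheme ℰp γ).β K * (((Q.filter fun e => e.1.val = 0).card : ℝ) * (θBal F.L γ b₀ p₀ K ^ 2 / 4))) ≤
      t * ((F.scheme ℰp γ).β K * wilsonAction4 V) :=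
    mul_le_mul_of_nonneg_left (mul_le_mul_of_nonneg_left hA hβ0) ht0
  have h2 : t * ((F.scheme ℰp γ).β K * (((Q.filter fun e => e.1.val = 0).card : ℝ) * (θBal F.L γ b₀ p₀ K ^ 2 / 4))) =
      ((Q.filter fun e => e.1.val = 0).card : ℝ) * (t / 4 * B10.pFun b₀ p₀ (Real.sqrt (γ * ((F.L : ℝ)⁻¹) ^ K)) ^ 2) := by
    rw [← hkey]; ring
  rw [h2] at h1
  have h3 : -((F.scheme ℰp γ).β K) * wilsonAction4 V =
      -(t * ((F.scheme ℰp γ).β K * wilsonAction4 V)) + -((1 - t) * ((F.scheme ℰp γ).β K * wilsonAction4 V)) := by ring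
  rw [h3]
  linarith

open Classical in
/-- **DEPTH ONE: ALL DEEP HOLES ARE FINEST-LEVEL HOLES.**  At `K = J + 1` a history `Q ⊆ LFLabel F (J+1) J` all of whose labels are deep (`j < (J + 1) − J = 1`, i.e. `j = 0`) satisfies
`Q.filter (j = 0) = Q`, so on `E_Q`: `e^{−β_{J+1} A(V)} ≤ (Π_{e ∈ Q} smallFactor L γ b₀ p₀ (t/4) (J+1)) · e^{−(1−t)β_{J+1}A(V)}` — the `Π_{l ∈ Q′} sf l` of the engine package's
energy row (`a := t/4`) for the first bite of the 𝐑-operation. [cite: Balaban1985UV3, (67)-(71) pp.273-274; Balaban1989LargeFieldII, (1.97) p.389] -/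
theorem boltzmann_le_prod_smallFactor_mul_depthOne {γ b₀ : ℝ} (p₀ : ℝ) (hγ : 0 < γ) (hγ1 : γ ≤ 1) (hb : 0 ≤ b₀) {t : ℝ} (ht0 : 0 ≤ t)
    {J : ℕ} (Q : Finset (LFLabel F (J + 1) J)) (hQ : ∀ e ∈ Q, e.1.val < J + 1 - J) {V : GaugeField (F.P (J + 1)) 0 (Matrix.specialUnitaryGroup (Fin 2) ℂ)}
    (hV : V ∈ histEvent F (θBal F.L γ b₀ p₀) (J + 1) J Q) :
    boltzmann (F.P (J + 1)) ((F.scheme ℰp γ).β (J + 1)) V ≤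
      (∏ e ∈ Q, smallFactor F.L γ b₀ p₀ (t / 4) (J + 1 - e.1.val)) *
        Real.exp (-((1 - t) * ((F.scheme ℰp γ).β (J + 1) * wilsonAction4 V))) := by
  have hlev : ∀ e ∈ Q, e.1.val = 0 := fun e he => by have := hQ e he; omega
  have hfilt : Q.filter (fun e => e.1.val = 0) = Q := Finset.filter_true_of_mem hlev
  have hprod : ∏ e ∈ Q, smallFactor F.L γ b₀ p₀ (t / 4) (J + 1 - e.1.val) = ∏ _e ∈ Q.filter (fun e => e.1.val = 0), smallFactor F.L γ b₀ p₀ (t / 4) (J + 1) := by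
    rw [hfilt]
    exact Finset.prod_congr rfl fun e he => by rw [hlev e he, Nat.sub_zero]
  rw [hprod]
  exact boltzmann_le_prod_smallFactor_mul p₀ hγ hγ1 hb ht0 Q hV

end Summit.QuantumFields.YangMills.Theorems.FluctuationComparisonRegPrIntLLargeFieldGasHoleEnergy

end
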